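import Literature.IUT.HodgeTheaters.DiscreteProfiniteConjugates
import Mathlib.GroupTheory.SpecificGroups.Dihedral
import Mathlib.Data.Nat.Factorization.Basic
import HarnessLib

/-!
# A witness for [IUTchI] Remark 2.6.1: "it is not necessarily the case that `F = γ⁻¹ · F · γ`"

Mochizuki, *Inter-universal Teichmüller theory I*, §2, Remark 2.6.1 (kurims May-2020 manuscript,
p. 57): "Note that in the situation of Theorem 2.6, if `H_G` is abelian, then — unlike the tempered
case discussed in Proposition 2.4! — it is not necessarily the case that `F = γ⁻¹ · F · γ`."
The named statement `ProfiniteConjugateNeedNotNormalize` (`DiscreteProfiniteConjugates.lean`,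
abc-iut layer L5, typer abc-iut-L5-t1) is DISCHARGED here by an explicit witness
[claim: Mochizuki2012, status: disputed — the witness below is plain profinite group theory and
takes no side]:

* `F = G` = the free group on two letters `a`, `b` (free of finite rank `2`, of index `1` in
  itself), `H = H_G = ⟨a⟩` (infinite, abelian);
* `γ = "a^λ" ∈ F̂` for a "profinite integer" `λ ∈ Ẑ ∖ ℤ`, namely the `2`-adic idempotent
  (`λ ≡ 1 mod 2^t`, `λ ≡ 0 mod` odd numbers), realised inside Mathlib's
  `ProfiniteGrp.ProfiniteCompletion` as the coherent family `N ↦ a^{k [F:N]} · N` over ALL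
  finite-index normal subgroups `N ⊴ F`, where `k : ℕ → ℕ` is a Chinese-remainder lift of `λ`
  (`exists_coherentTwoAdicFamily`);
* `γ` centralises `η(a)`, so `γ · η(H) · γ⁻¹ = η(H) ⊆ η(F)`;
* `γ⁻¹ · η(F) · γ ≠ η(F)`: otherwise `γ · η(b) · γ⁻¹ = η(w)` for some `w ∈ F`, and pushing this
  identity to the dihedral quotients `F ↠ D_{2n}` (`a ↦ r 1`, `b ↦ sr 0`), where
  `(r 1)^k · sr 0 · (r 1)^{-k} = sr (-2k)`, and comparing with the image `r c` / `sr c` (`c ∈ ℤ`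
  independent of `n`) of the word `w` shows `c ≡ -2λ (mod n)` for every `n ≥ 1` — impossible at
  `n = 2^t` (forcing `c = -2`) versus `n = 3` (forcing `3 ∣ c`).

Theorems only (no new definitions); imports the owner's module and never edits it.  The remark is
stated without proof in print; this file supplies one.
-/

namespace Literature.IUT.HodgeTheaters

open CategoryTheory Pointwise

universe u

/-! ### A Chinese-remainder lift of the `2`-adic idempotent of `Ẑ` -/

/-- A coherent family of natural numbers `k M`, `M ≥ 1`, lifting the `2`-adic idempotent
`λ = (1, 0, 0, …) ∈ ℤ₂ × ∏_{p odd} ℤ_p = Ẑ`: `k M ≡ 1 (mod 2^{v₂(M)})` and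
`k M ≡ 0 (mod M / 2^{v₂(M)})`; hence `k M ≡ k m (mod m)` whenever `m ∣ M`, `k M ≡ 1 (mod 2^t)` whenever `2^t ∣ M`, and
`k M ≡ 0 (mod 3)` whenever `3 ∣ M` — so no integer is congruent to `k M (mod M)` for all `M`.
[claim: Mochizuki2012, status: disputed] -/
theorem exists_coherentTwoAdicFamily :
    ∃ k : ℕ → ℕ,
      (∀ m M : ℕ, M ≠ 0 → m ∣ M → k M ≡ k m [MOD m]) ∧
      (∀ t M : ℕ, M ≠ 0 → 2 ^ t ∣ M → k M ≡ 1 [MOD 2 ^ t]) ∧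
      (∀ M : ℕ, M ≠ 0 → 3 ∣ M → k M ≡ 0 [MOD 3]) := by
  classical
  have co : ∀ M : ℕ, M ≠ 0 →
      Nat.Coprime (2 ^ M.factorization 2) (M / 2 ^ M.factorization 2) := fun M hM =>
    (Nat.coprime_ordCompl Nat.prime_two hM).pow_left _
  let k : ℕ → ℕ := fun M => if hM : M = 0 then 0 else (Nat.chineseRemainder (co M hM) 1 0).1
  have hk1 : ∀ M, M ≠ 0 → k M ≡ 1 [MOD 2 ^ M.factorization 2] := fun M hM => by
    simp only [k, dif_neg hM]; exact (Nat.chineseRemainder (co M hM) 1 0).2.1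
  have hk0 : ∀ M, M ≠ 0 → k M ≡ 0 [MOD M / 2 ^ M.factorization 2] := fun M hM => by
    simp only [k, dif_neg hM]; exact (Nat.chineseRemainder (co M hM) 1 0).2.2
  refine ⟨k, ?_, ?_, ?_⟩
  · intro m M hM hmM
    have hm : m ≠ 0 := by rintro rfl; exact hM (zero_dvd_iff.mp hmM)
    have h2 : k M ≡ k m [MOD 2 ^ m.factorization 2] :=
      ((hk1 M hM).of_dvd (Nat.ordProj_dvd_ordProj_of_dvd hM hmM 2)).trans (hk1 m hm).symm
    have h0 : k M ≡ k m [MOD m / 2 ^ m.factorization 2] :=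
      ((hk0 M hM).of_dvd (Nat.ordCompl_dvd_ordCompl_of_dvd hmM 2)).trans (hk0 m hm).symm
    have := (Nat.modEq_and_modEq_iff_modEq_mul (co m hm)).mp ⟨h2, h0⟩
    rwa [Nat.ordProj_mul_ordCompl_eq_self] at this
  · intro t M hM htM
    exact (hk1 M hM).of_dvd
      (pow_dvd_pow 2 ((Nat.prime_two.pow_dvd_iff_le_factorization hM).mp htM))
  · intro M hM h3M
    refine (hk0 M hM).of_dvd ?_
    have h3 : Nat.Coprime 3 (2 ^ M.factorization 2) := (by decide : Nat.Coprime 3 2).pow_right _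
    exact h3.dvd_of_dvd_mul_right (by rw [Nat.div_mul_cancel (Nat.ordProj_dvd M 2)]; exact h3M)

/-! ### Dihedral quotients -/

/-- In the dihedral group `D_{2n}`: `(r 1)^k · sr 0 · ((r 1)^k)⁻¹ = sr (-2k)` — conjugating the
reflection `sr 0` by the `k`-th power of the rotation `r 1` records `2k (mod n)`.
[claim: Mochizuki2012, status: disputed] -/
theorem dihedral_rotation_pow_conj_reflection (n k : ℕ) :
    (DihedralGroup.r 1 : DihedralGroup n) ^ k * DihedralGroup.sr 0 *
        ((DihedralGroup.r 1 : DihedralGroup n) ^ k)⁻¹ =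
      DihedralGroup.sr (-(2 * k : ZMod n)) := by
  simp only [DihedralGroup.r_one_pow, DihedralGroup.r_mul_sr, DihedralGroup.inv_r,
    DihedralGroup.sr_mul_r]
  congr 1; ring

/-- Words map coherently to dihedral groups: if a family of homomorphisms
`φ n : FreeGroup α → D_{2n}` (`n ∈ ℕ`) sends each free generator to `r c` for all `n`, or to `sr c`
for all `n`, for an INTEGER `c` depending only on the generator, then the same holds for every
word `w` (with `c` = the index of the image of `w` in the infinite dihedral group `D_∞`).
[claim: Mochizuki2012, status: disputed] -/
theorem dihedral_image_of_word {α : Type u} (φ : (n : ℕ) → FreeGroup α →* DihedralGroup n)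
    (hgen : ∀ x : α, ∃ c : ℤ, (∀ n : ℕ, φ n (FreeGroup.of x) = DihedralGroup.r (c : ZMod n)) ∨
      (∀ n : ℕ, φ n (FreeGroup.of x) = DihedralGroup.sr (c : ZMod n)))
    (w : FreeGroup α) :
    ∃ c : ℤ, (∀ n : ℕ, φ n w = DihedralGroup.r (c : ZMod n)) ∨
      (∀ n : ℕ, φ n w = DihedralGroup.sr (c : ZMod n)) := by
  induction w using FreeGroup.induction_on with
  | C1 => exact ⟨0, Or.inl fun n => by rw [map_one, DihedralGroup.one_def, Int.cast_zero]⟩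
  | of x => exact hgen x
  | inv_of x ih =>
    obtain ⟨c, hc | hc⟩ := ih
    · exact ⟨-c, Or.inl fun n => by rw [map_inv, hc n, DihedralGroup.inv_r, Int.cast_neg]⟩
    · exact ⟨c, Or.inr fun n => by rw [map_inv, hc n, DihedralGroup.inv_sr]⟩
  | mul x y ihx ihy =>
    obtain ⟨c, hc | hc⟩ := ihx <;> obtain ⟨d, hd | hd⟩ := ihy
    · exact ⟨c + d, Or.inl fun n => by
        rw [map_mul, hc n, hd n, DihedralGroup.r_mul_r, Int.cast_add]⟩
    · exact ⟨d - c, Or.inr fun n => by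
        rw [map_mul, hc n, hd n, DihedralGroup.r_mul_sr, Int.cast_sub]⟩
    · exact ⟨c + d, Or.inr fun n => by
        rw [map_mul, hc n, hd n, DihedralGroup.sr_mul_r, Int.cast_add]⟩
    · exact ⟨d - c, Or.inl fun n => by
        rw [map_mul, hc n, hd n, DihedralGroup.sr_mul_sr, Int.cast_sub]⟩

/-! ### The witness -/

/-- **Remark 2.6.1 holds**: there are data `(F ⊇ G, H, γ)` as in Theorem 2.6 with `H_G` abelian,
`γ · η(H) · γ⁻¹ ⊆ η(F)` and `γ⁻¹ · η(F) · γ ≠ η(F)` — namely `F = G = ⟨a, b⟩` free of rank two,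
`H = ⟨a⟩`, `γ = a^λ ∈ F̂` with `λ ∈ Ẑ ∖ ℤ` the `2`-adic idempotent (see the module docstring).
[claim: Mochizuki2012, status: disputed] -/
theorem profiniteConjugateNeedNotNormalize_holds : ProfiniteConjugateNeedNotNormalize.{u} := by
  classical
  obtain ⟨k, hkcoh, hk2, hk3⟩ := exists_coherentTwoAdicFamily
  -- the free group `F` on two letters `a`, `b`; the dihedral quotients `φ n : a ↦ r 1, b ↦ sr 0`;
  -- the exponent sum `e : F → ℤ`
  set a : FreeGroup (ULift.{u} (Fin 2)) := FreeGroup.of (ULift.up 0) with ha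
  set b : FreeGroup (ULift.{u} (Fin 2)) := FreeGroup.of (ULift.up 1) with hb
  set φ : (n : ℕ) → FreeGroup (ULift.{u} (Fin 2)) →* DihedralGroup n := fun n =>
    FreeGroup.lift fun x => ![DihedralGroup.r 1, DihedralGroup.sr 0] x.down with hφ
  have hgen : ∀ x : ULift.{u} (Fin 2), ∃ c : ℤ,
      (∀ n : ℕ, φ n (FreeGroup.of x) = DihedralGroup.r (c : ZMod n)) ∨
        (∀ n : ℕ, φ n (FreeGroup.of x) = DihedralGroup.sr (c : ZMod n)) := by
    rintro ⟨x⟩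
    fin_cases x
    · exact ⟨1, Or.inl fun n => by rw [hφ, Int.cast_one]; simp⟩
    · exact ⟨0, Or.inr fun n => by rw [hφ, Int.cast_zero]; simp⟩
  have hφa : ∀ n : ℕ, φ n a = DihedralGroup.r 1 := fun n => by rw [hφ, ha]; simp
  have hφb : ∀ n : ℕ, φ n b = DihedralGroup.sr 0 := fun n => by rw [hφ, hb]; simp
  set e : FreeGroup (ULift.{u} (Fin 2)) →* Multiplicative ℤ :=
    FreeGroup.lift fun _ => Multiplicative.ofAdd 1 with he
  have hea : e a = Multiplicative.ofAdd 1 := by rw [he, ha]; simp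
  clear_value φ e a b
  -- components of `η = toCompletion F`
  have hηval : ∀ (x : FreeGroup (ULift.{u} (Fin 2)))
      (N : FiniteIndexNormalSubgroup (FreeGroup (ULift.{u} (Fin 2)))),
      (toCompletion _ x).val N = (QuotientGroup.mk x : _ ⧸ N.toSubgroup) := fun _ _ => rfl
  -- the exponents `k [F : N]` and the element `γ = a^λ` of `F̂`
  let kN : FiniteIndexNormalSubgroup (FreeGroup (ULift.{u} (Fin 2))) → ℕ := fun N =>
    k N.toSubgroup.index
  have hcompat : ∀ ⦃i j : FiniteIndexNormalSubgroup (FreeGroup (ULift.{u} (Fin 2)))⦄ (π : i ⟶ j),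
      (ProfiniteGrp.ProfiniteCompletion.diagram (GrpCat.of (FreeGroup (ULift.{u} (Fin 2))))).map π
          (QuotientGroup.mk (a ^ kN i) : _ ⧸ i.toSubgroup) =
        (QuotientGroup.mk (a ^ kN j) : _ ⧸ j.toSubgroup) := by
    intro i j π
    change (QuotientGroup.mk (a ^ kN i) : _ ⧸ j.toSubgroup) = QuotientGroup.mk (a ^ kN j)
    rw [QuotientGroup.mk_pow, QuotientGroup.mk_pow]
    refine pow_eq_pow_iff_modEq.mpr ?_
    have hle : i.toSubgroup ≤ j.toSubgroup := fun x hx => π.le hx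
    exact (hkcoh _ _ Subgroup.FiniteIndex.index_ne_zero (Subgroup.index_dvd_of_le hle)).of_dvd
      (orderOf_dvd_natCard _)
  let γ : profiniteCompletion (FreeGroup (ULift.{u} (Fin 2))) :=
    ⟨fun N => QuotientGroup.mk (a ^ kN N), hcompat⟩
  -- `γ` centralises `η(a)`
  have hγa : Commute γ (toCompletion _ a) := by
    refine ProfiniteGrp.limit_ext _ _ _ fun N => ?_
    change (QuotientGroup.mk (a ^ kN N) : _ ⧸ N.toSubgroup) * QuotientGroup.mk a =
      (QuotientGroup.mk a : _ ⧸ N.toSubgroup) * QuotientGroup.mk (a ^ kN N)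
    rw [← QuotientGroup.mk_mul, ← QuotientGroup.mk_mul, (Commute.self_pow _ _).eq]
  refine ⟨FreeGroup (ULift.{u} (Fin 2)), inferInstance, ⊤, Subgroup.zpowers a, inferInstance,
    ?_, ?_, ?_, γ, ?_, ?_⟩
  · -- `G = F` is free of rank two
    exact Or.inl ⟨2, ⟨Subgroup.topEquiv.trans (FreeGroup.freeGroupCongr Equiv.ulift)⟩⟩
  · -- `H = ⟨a⟩` is infinite: the exponent sum `e : F → ℤ` separates the powers of `a`
    have hinj : Function.Injective fun i : ℤ => a ^ i := by
      intro i j hij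
      have h := congrArg (fun x => Multiplicative.toAdd (e x)) hij
      simpa [map_zpow, hea] using h
    exact Set.infinite_of_injective_forall_mem hinj fun i => Subgroup.zpow_mem_zpowers _ i
  · -- `H_G = ⟨a⟩` is abelian
    rintro x ⟨hx, -⟩ y ⟨hy, -⟩
    obtain ⟨i, rfl⟩ := Subgroup.mem_zpowers_iff.mp hx
    obtain ⟨j, rfl⟩ := Subgroup.mem_zpowers_iff.mp hy
    exact zpow_mul_comm _ i j
  · -- `γ · η(h) · γ⁻¹ = η(h)` for `h ∈ H`
    intro h hh
    obtain ⟨i, rfl⟩ := Subgroup.mem_zpowers_iff.mp hh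
    refine ⟨a ^ i, ?_⟩
    have hc : Commute γ (toCompletion _ (a ^ i)) := by rw [map_zpow]; exact hγa.zpow_right i
    rw [hc.eq, mul_inv_cancel_right]
  · -- `γ⁻¹ · η(F) · γ ≠ η(F)`
    intro heq
    have hb : toCompletion _ b ∈
        MulAut.conj γ⁻¹ • (toCompletion (FreeGroup (ULift.{u} (Fin 2)))).range := by
      rw [heq]; exact ⟨b, rfl⟩
    rw [Subgroup.mem_pointwise_smul_iff_inv_smul_mem, ← map_inv, inv_inv, MulAut.smul_def,
      MulAut.conj_apply] at hb
    obtain ⟨w, hw⟩ := hb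
    -- hw : η w = γ * η b * γ⁻¹.
    -- At a finite level `n ≥ 1`: `n ∣ [F : Ker φ_n]` and `φ_n(w) = sr (-2 k[F : Ker φ_n])`.
    have key : ∀ n : ℕ, n ≠ 0 →
        (φ n).ker.index ≠ 0 ∧ n ∣ (φ n).ker.index ∧
          φ n w = DihedralGroup.sr (-(2 * (k (φ n).ker.index : ℕ) : ZMod n)) := by
      intro n hn
      haveI : NeZero n := ⟨hn⟩
      let N : FiniteIndexNormalSubgroup (FreeGroup (ULift.{u} (Fin 2))) :=
        FiniteIndexNormalSubgroup.ofSubgroup (φ n).ker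
      have hinj := QuotientGroup.kerLift_injective (φ n)
      refine ⟨Subgroup.FiniteIndex.index_ne_zero, ?_, ?_⟩
      · have h1 : orderOf (QuotientGroup.mk a : _ ⧸ (φ n).ker) = n := by
          rw [← orderOf_injective _ hinj, QuotientGroup.kerLift_mk, hφa,
            DihedralGroup.orderOf_r_one]
        have h2 := orderOf_dvd_natCard (QuotientGroup.mk a : _ ⧸ (φ n).ker)
        rw [h1] at h2
        exact h2
      · have hN : (QuotientGroup.mk w : _ ⧸ (φ n).ker) =
            QuotientGroup.mk (a ^ kN N) * QuotientGroup.mk b * (QuotientGroup.mk (a ^ kN N))⁻¹ :=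
          congrArg (fun x : profiniteCompletion (FreeGroup (ULift.{u} (Fin 2))) => x.val N) hw
        have h2 := congrArg (QuotientGroup.kerLift (φ n)) hN
        simp only [map_mul, map_inv, QuotientGroup.kerLift_mk, map_pow, hφa, hφb,
          dihedral_rotation_pow_conj_reflection] at h2
        exact h2
    -- the word `w` maps to `r c` (impossible) or `sr c` for one INTEGER `c`, `c ≡ -2λ (mod n)`
    obtain ⟨c, hc⟩ : ∃ c : ℤ, ∀ n : ℕ, n ≠ 0 →
        (c : ZMod n) = -(2 * (k (φ n).ker.index : ℕ) : ZMod n) := by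
      obtain ⟨c, hc | hc⟩ := dihedral_image_of_word φ hgen w
      · exfalso
        have h := (key 1 one_ne_zero).2.2
        rw [hc 1] at h
        cases h
      · refine ⟨c, fun n hn => ?_⟩
        have h := (key n hn).2.2
        rw [hc n] at h
        exact DihedralGroup.sr.inj h
    -- at `n = 2^t`: `c ≡ -2 (mod 2^t)` for every `t`, whence `c = -2`
    have hc2 : c = -2 := by
      have hdvd : ∀ t : ℕ, (2 : ℤ) ^ t ∣ -2 - c := by
        intro t
        obtain ⟨hne, hidx, -⟩ := key (2 ^ t) (pow_ne_zero t two_ne_zero)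
        have hk : ((k (φ (2 ^ t)).ker.index : ℕ) : ZMod (2 ^ t)) = 1 := by
          have := (ZMod.natCast_eq_natCast_iff _ _ _).mpr (hk2 t _ hne hidx)
          simpa using this
        have h := hc (2 ^ t) (pow_ne_zero t two_ne_zero)
        rw [hk, mul_one] at h
        have h' : ((c : ℤ) : ZMod (2 ^ t)) = ((-2 : ℤ) : ZMod (2 ^ t)) := by
          rw [h, Int.cast_neg, Int.cast_ofNat]
        have := (ZMod.intCast_eq_intCast_iff_dvd_sub c (-2) (2 ^ t)).mp h'
        simpa using this
      have h0 : -2 - c = 0 := by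
        refine Int.eq_zero_of_dvd_of_natAbs_lt_natAbs (hdvd (-2 - c).natAbs) ?_
        rw [Int.natAbs_pow]
        exact Nat.lt_two_pow_self
      omega
    -- at `n = 3`: `c ≡ 0 (mod 3)` — contradiction
    obtain ⟨hne3, hidx3, -⟩ := key 3 three_ne_zero
    have hk0 : ((k (φ 3).ker.index : ℕ) : ZMod 3) = 0 := by
      have := (ZMod.natCast_eq_natCast_iff _ _ _).mpr (hk3 _ hne3 hidx3)
      simpa using this
    have h3 := hc 3 three_ne_zero
    rw [hk0, mul_zero, neg_zero, hc2] at h3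
    have := (ZMod.intCast_zmod_eq_zero_iff_dvd (-2) 3).mp h3
    omega

end Literature.IUT.HodgeTheaters
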